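import Literature.NumberTheory.DiophantineGeometry.MordellAlmostPrimitiveHeightBoundsProofs
import Literature.NumberTheory.EllipticCurves.HeightConductorBoundsPropTenEightAsymptoticProofs
import Mathlib.Analysis.Complex.ExponentialBounds
import HarnessLib

/-!
# von Känel–Matschke, Theorem 7.2 (ii) (the asymptotic bound for primitive solutions of Mordell equations)
# from the §10 roots — the printed proof of §10.3 in kernel

Topic `Literature/NumberTheory/DiophantineGeometry` (family `abc`). Theorems only — NO definition, NO new named
fact (D-0014, D-0026). R. von Känel, B. Matschke, arXiv:1605.06079 = Mem. AMS 286 (2023) no. 1419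
[`VonkanelMatschke2023`], §10.3, end of "Proof of Theorem (thm:m)": *"To prove (ii) we may and do assume that
`|a| → ∞` and that `S` is empty. Let `(x,y) ∈ ℤ × ℤ` be a primitive solution of (eq:mordell), and take
`(x',y') = (x,y)` and `a' = a` in the proof of (i). Then (eq:deltaea) and (eq:szpiro) show that
`log|a| ≤ O(N_E²)` and thus `|a| → ∞` forces `N_E → ∞`. Hence on using (eq:primitivesolestimate) with `μ = 0`
and on applying the asymptotic bound for `h(E)` in terms of `N_E` given in Proposition (prop:explbounds), we
see that (eq:deltaea) together with `a_S = a_*` leads to the asymptotic estimate claimed in (ii)."*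

## What is proved here

`theorem_7_2_ii_of_roots` — **`theorem_7_2_ii` ⇐ {modularity (`nonempty_modularParametrizationData`),
Lemma 10.4, Prop. 10.8 (i)}**, Prop. 10.8 (ii) and (iii) being THEOREMS of the tree
(`vonKanelMatschke_prop_10_8_ii_holds`, `…_iii_holds`). Kernel rendering of the printed sketch, for a given
`δ > 0`: with `N₀ = N₀(δ/4)` from Prop. 10.8 (iii) and `N₁ = max(N₀, 16, ⌈(48/δ)² + 367/δ⌉)`, the threshold is
`A₀ = exp(123 + 3N₁²)`; indeed `log|a| ≤ log 1728 + log Δ_E` (Lemma 10.4 (i)) and the explicit (eq:szpiro)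
give `log|a| < 123 + 3N_E²` (`conductor_ge_of_log_abs_ge`), so `|a| ≥ A₀` forces `N_E ≥ N₁`; then
`2h(E) ≤ κ + β(N_E)` (Prop. 10.8 (i)), `β(N) ≤ (1/8)ν log N + ((1/6)log 2 + δ/4) ν log N/log log N` (iii),
`ν(N_E) ≤ (2/3)a_*`, `log N_E ≤ log a_*`, monotonicity of `t ↦ t/log t` on `[e, ∞)`, Lemma 10.4 (iii)
`max(h(x),(2/3)h(y)) ≤ 4h(E) + 2 log max(1,h(E)) + 28` and `2κ + 28 + 2 log max(1, h(E)) ≤ 61.1 + 8√a_* ≤ (δ/3)a_*`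
assemble (`asymptotic_assembly`) to `(1/6)a_* log a_* + ((2/9)log 2 + δ)/(log log a_*) · a_* log a_*`.

With `MordellAlmostPrimitiveHeightBoundsProofs` (Thm. 7.2 (i)) the whole of vKM Theorem 7.2 is derived from
{modularity, Lemma 10.3, Lemma 10.4, Prop. 10.8 (i)}. No `abc` claim; axioms standard.
-/

noncomputable section

open Height WeierstrassCurve
open Literature.NumberTheory.EllipticCurves.ModularForms

namespace Literature.NumberTheory.DiophantineGeometry

namespace VonKanelMatschke

/-! ### Real-analysis helpers -/

/-- `e ≤ log x` for `x ≥ 16` (`log 16 = 4 log 2 > 2.77 > e`). [folklore] -/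
private theorem exp_one_le_log_16 {x : ℝ} (hx : 16 ≤ x) : Real.exp 1 ≤ Real.log x := by
  have hl2 := Real.log_two_gt_d9
  have he := Real.exp_one_lt_d9
  have h16 : Real.log 16 = 4 * Real.log 2 := by
    rw [show (16 : ℝ) = 2 ^ 4 by norm_num, Real.log_pow]; push_cast; ring
  have := Real.log_le_log (by norm_num) hx
  linarith

/-- `1 ≤ log log x` for `x ≥ 16`. [folklore] -/
private theorem one_le_loglog_16 {x : ℝ} (hx : 16 ≤ x) : 1 ≤ Real.log (Real.log x) := by
  have := Real.log_le_log (Real.exp_pos 1) (exp_one_le_log_16 hx)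
  rwa [Real.log_exp] at this

/-- `t ↦ t/log t` is monotone on `[e, ∞)`: for `e ≤ u ≤ w`, `u/log u ≤ w/log w`
(`log w ≤ log u + (w/u − 1)` and `log u ≥ 1`). [folklore] -/
private theorem div_log_mono {u w : ℝ} (hu : Real.exp 1 ≤ u) (huw : u ≤ w) :
    u / Real.log u ≤ w / Real.log w := by
  have hu0 : 0 < u := lt_of_lt_of_le (Real.exp_pos 1) hu
  have hw0 : 0 < w := by linarith
  have hlu : 1 ≤ Real.log u := by
    have := Real.log_le_log (Real.exp_pos 1) hu
    rwa [Real.log_exp] at this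
  have hlw : 1 ≤ Real.log w := hlu.trans (Real.log_le_log hu0 huw)
  have h1 : Real.log w = Real.log u + Real.log (w / u) := by
    rw [← Real.log_mul hu0.ne' (by positivity)]; congr 1; field_simp
  have h2 : Real.log (w / u) ≤ w / u - 1 := Real.log_le_sub_one_of_pos (by positivity)
  have h3 : u * Real.log (w / u) ≤ w - u := by
    have := mul_le_mul_of_nonneg_left h2 hu0.le
    have e : u * (w / u - 1) = w - u := by field_simp
    linarith
  have h4 : u * Real.log w ≤ w * Real.log u := by
    rw [h1, mul_add]; nlinarith
  rw [div_le_div_iff₀ (by linarith) (by linarith)]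
  linarith

/-- `log x ≤ 2√x` for `x > 0` (`log x = 2 log √x ≤ 2(√x − 1)`). [folklore] -/
private theorem log_le_two_sqrt {x : ℝ} (hx : 0 < x) : Real.log x ≤ 2 * Real.sqrt x := by
  have h1 : Real.log (Real.sqrt x) = Real.log x / 2 := Real.log_sqrt hx.le
  have h2 : Real.log (Real.sqrt x) ≤ Real.sqrt x - 1 := Real.log_le_sub_one_of_pos (Real.sqrt_pos.mpr hx)
  linarith

/-- `log 1728 ≤ 7.63`, local copy. [folklore] -/
private theorem log_1728_le' : Real.log 1728 ≤ 7.63 := by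
  have hl2 := Real.log_two_lt_d9
  have h1 : Real.log (1728 : ℝ) ≤ Real.log 2048 := Real.log_le_log (by norm_num) (by norm_num)
  rw [show (2048 : ℝ) = 2 ^ 11 by norm_num, Real.log_pow] at h1
  push_cast at h1; linarith

/-! ### "`|a| → ∞` forces `N_E → ∞`" -/

/-- **"(eq:deltaea) and (eq:szpiro) show that `log|a| ≤ O(N_E²)` and thus `|a| → ∞` forces `N_E → ∞`"**
(§10.3), quantified: if `11 ≤ N`, `0 ≤ ν ≤ N`, `log Δ ≤ ν log N + (3/8)ν log₃N + (2/3)ν + 115.1`,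
`log|a| ≤ log 1728 + log Δ` and `123 + 3N₁² ≤ log|a|`, then `N₁ ≤ N` (`log|a| < 123 + 3N²`).
[cite: VonkanelMatschke2023, §10.3 (end of the proof of Thm. 7.2)] -/
theorem conductor_ge_of_log_abs_ge {N N₁ : ℕ} {ν lΔ la : ℝ} (hN11 : 11 ≤ N) (hν0 : 0 ≤ ν) (hνN : ν ≤ N)
    (hΔ : lΔ ≤ ν * Real.log N + 3 / 8 * ν * Real.log (Real.log (Real.log N)) + 2 / 3 * ν + 115.1)
    (hla : la ≤ Real.log 1728 + lΔ) (hlow : 123 + 3 * (N₁ : ℝ) ^ 2 ≤ la) : N₁ ≤ N := by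
  by_contra hlt
  push Not at hlt
  have hl2 := Real.log_two_gt_d9
  have hN' : (11 : ℝ) ≤ N := by exact_mod_cast hN11
  have hlogN2 : 2 ≤ Real.log (N : ℝ) := by
    have h8 : Real.log 8 = 3 * Real.log 2 := by
      rw [show (8 : ℝ) = 2 ^ 3 by norm_num, Real.log_pow]; push_cast; ring
    have := Real.log_le_log (by norm_num) (show (8 : ℝ) ≤ N by linarith)
    linarith
  have hlogN : Real.log (N : ℝ) ≤ N := Real.log_le_self (by linarith)
  have hl3N : Real.log (Real.log (Real.log (N : ℝ))) ≤ Real.log N := by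
    have h1 : 0 ≤ Real.log (Real.log (N : ℝ)) := Real.log_nonneg (by linarith)
    exact (Real.log_le_self h1).trans (Real.log_le_self (by linarith))
  have t1 : ν * Real.log N ≤ (N : ℝ) * N := mul_le_mul hνN hlogN (by linarith) (by linarith)
  have t2 : ν * Real.log (Real.log (Real.log (N : ℝ))) ≤ (N : ℝ) * N :=
    (mul_le_mul_of_nonneg_left (hl3N.trans hlogN) hν0).trans (mul_le_mul_of_nonneg_right hνN (by linarith))
  have h17 := log_1728_le'
  have hNN : (N : ℝ) + 1 ≤ N₁ := by exact_mod_cast hlt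
  have hN0 : (0 : ℝ) ≤ N := by linarith
  nlinarith

/-! ### The real-analysis assembly of the asymptotic display -/

/-- **The assembly of §10.3 for Thm. 7.2 (ii)**, as a statement about real numbers: with `M = a_* ≥ 1728`,
`M ≥ (48/δ)² + 367/δ`, `16 ≤ N ≤ M`, `0 ≤ ν ≤ (2/3)M`, the asymptotic height bound
`2h ≤ κ + (1/8)ν log N + ((1/6)log 2 + δ/4)/(log log N)·(ν log N)` ((i)+(iii)), the explicit companion
`2h ≤ κ + (1/9)M log M + (1/24)M log₃M + (2/27)M` ((i)+(ii), for the `log max(1,h)` term) and Lemma 10.4 (iii)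
`T ≤ 4h + 2 log max(1,h) + 28`, one gets `T ≤ (1/6)M log M + ((2/9)log 2 + δ)/(log log M)·(M log M)`.
[cite: VonkanelMatschke2023, §10.3 (end of the proof of Thm. 7.2) with Prop. 10.8 (iii)] -/
theorem asymptotic_assembly {δ M N ν h T : ℝ} (hδ : 0 < δ) (hM : 1728 ≤ M) (hM₁M : (48 / δ) ^ 2 + 367 / δ ≤ M)
    (hN16 : 16 ≤ N) (hNM : N ≤ M) (hν0 : 0 ≤ ν) (hν : ν ≤ 2 / 3 * M)
    (h2h : 2 * h ≤ vkmKappa + (1 / 8 * ν * Real.log N +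
      (1 / 6 * Real.log 2 + δ / 4) / Real.log (Real.log N) * (ν * Real.log N)))
    (h2h' : 2 * h ≤ vkmKappa + (1 / 9 * M * Real.log M + 1 / 24 * M * Real.log (Real.log (Real.log M)) +
      2 / 27 * M))
    (hT : T ≤ 4 * h + 2 * Real.log (max 1 h) + 28) :
    T ≤ 1 / 6 * M * Real.log M + (2 / 9 * Real.log 2 + δ) / Real.log (Real.log M) * (M * Real.log M) := by
  have hκ := vkmKappa_le
  have hl2 := Real.log_two_gt_d9
  have hM0 : 0 ≤ M := by linarith
  have hM16 : (16 : ℝ) ≤ M := by linarith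
  have hllN : 1 ≤ Real.log (Real.log N) := one_le_loglog_16 hN16
  have hllM : 1 ≤ Real.log (Real.log M) := one_le_loglog_16 hM16
  have heN := exp_one_le_log_16 hN16
  have hlogN0 : 0 ≤ Real.log N := by linarith [Real.exp_pos (1 : ℝ)]
  have hlogNM : Real.log N ≤ Real.log M := Real.log_le_log (by linarith) hNM
  have hlogM0 : 0 ≤ Real.log M := hlogN0.trans hlogNM
  have hmono : Real.log N / Real.log (Real.log N) ≤ Real.log M / Real.log (Real.log M) :=
    div_log_mono heN hlogNM
  set X : ℝ := M * Real.log M / Real.log (Real.log M) with hX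
  -- `ν log N ≤ (2/3) M log M`, `ν log N/log log N ≤ (2/3) X`
  have hν1 : ν * Real.log N ≤ 2 / 3 * M * Real.log M :=
    (mul_le_mul_of_nonneg_left hlogNM hν0).trans (mul_le_mul_of_nonneg_right hν hlogM0)
  have hkey : ν * Real.log N / Real.log (Real.log N) ≤ 2 / 3 * X := by
    have e1 : ν * Real.log N / Real.log (Real.log N) = ν * (Real.log N / Real.log (Real.log N)) := by ring
    have e2 : 2 / 3 * X = (2 / 3 * M) * (Real.log M / Real.log (Real.log M)) := by rw [hX]; ring
    rw [e1, e2]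
    exact mul_le_mul hν hmono (div_nonneg hlogN0 (by linarith)) (by linarith)
  have hc0 : 0 ≤ 1 / 6 * Real.log 2 + δ / 4 := by linarith
  have hmain : (1 / 6 * Real.log 2 + δ / 4) / Real.log (Real.log N) * (ν * Real.log N) ≤
      (1 / 6 * Real.log 2 + δ / 4) * (2 / 3 * X) := by
    have e : (1 / 6 * Real.log 2 + δ / 4) / Real.log (Real.log N) * (ν * Real.log N) =
        (1 / 6 * Real.log 2 + δ / 4) * (ν * Real.log N / Real.log (Real.log N)) := by ring
    rw [e]; exact mul_le_mul_of_nonneg_left hkey hc0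
  -- `M ≤ X`
  have hXM : M ≤ X := by
    have h1 : 1 ≤ Real.log M / Real.log (Real.log M) := by
      rw [le_div_iff₀ (by linarith), one_mul]; exact Real.log_le_self hlogM0
    have : M * 1 ≤ M * (Real.log M / Real.log (Real.log M)) := mul_le_mul_of_nonneg_left h1 hM0
    rw [hX, mul_div_assoc]; linarith
  -- the remainder `2κ + 28 + 2 log max(1,h) ≤ (δ/3) M ≤ (δ/3) X`
  have hlogmax := two_log_max_le_of_two_mul_le hM h2h'
  have hsqrt : Real.log M ≤ 2 * Real.sqrt M := log_le_two_sqrt (by linarith)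
  have hs0 : 0 ≤ Real.sqrt M := Real.sqrt_nonneg M
  have h367 : 0 < 367 / δ := div_pos (by norm_num) hδ
  have hsM : 48 / δ ≤ Real.sqrt M := by
    rw [Real.le_sqrt (by positivity) hM0]; linarith
  have hrem1 : 8 * Real.sqrt M ≤ δ / 6 * M := by
    have e : Real.sqrt M * Real.sqrt M = M := Real.mul_self_sqrt hM0
    have h48 : 48 ≤ δ * Real.sqrt M := by
      have := mul_le_mul_of_nonneg_left hsM hδ.le
      rwa [mul_div_cancel₀ _ hδ.ne'] at this
    nlinarith
  have hrem2 : 367 / 6 ≤ δ / 6 * M := by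
    have h1 : 367 / δ ≤ M := le_trans (by nlinarith [sq_nonneg (48 / δ)]) hM₁M
    have := mul_le_mul_of_nonneg_left h1 hδ.le
    rw [mul_div_cancel₀ _ hδ.ne'] at this
    linarith
  have hδX : δ / 3 * M ≤ δ / 3 * X := mul_le_mul_of_nonneg_left hXM (by linarith)
  have hX0 : 0 ≤ X := hM0.trans hXM
  have e3 : (2 / 9 * Real.log 2 + δ) / Real.log (Real.log M) * (M * Real.log M) =
      (2 / 9 * Real.log 2 + δ) * X := by rw [hX]; ring
  rw [e3]
  nlinarith

/-! ### Theorem 7.2 (ii) from the roots -/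

/-- **vKM Theorem 7.2 (ii) ⟸ {modularity, Lemma 10.4, Prop. 10.8 (i)}** (PROVED; Prop. 10.8 (ii), (iii) are
theorems of the tree): for every `δ > 0` there is `A₀` such that every primitive `(x, y) ∈ ℤ × ℤ` with
`y² = x³ + a`, `|a| ≥ A₀`, satisfies `max(h(x), (2/3)h(y)) ≤ (1/6)a_* log a_* + ((2/9)log 2 + δ)/(log log a_*)·a_* log a_*`.
See the module docstring for the thresholds. [cite: VonkanelMatschke2023, Thm. 7.2 (ii) (arXiv §7, thm:m) with §10.3 (end of the proof of Thm. 7.2)] -/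
theorem theorem_7_2_ii_of_roots (hmod : nonempty_modularParametrizationData)
    (h104 : vonKanelMatschke_lemma_10_4) (hi : vonKanelMatschke_prop_10_8_i) : theorem_7_2_ii := by
  intro δ hδ
  obtain ⟨N₀, hN₀⟩ := vonKanelMatschke_prop_10_8_iii_holds (δ / 4) (by linarith)
  set M₁ : ℝ := (48 / δ) ^ 2 + 367 / δ with hM₁
  set N₁ : ℕ := max (max N₀ 16) ⌈M₁⌉₊ with hN₁
  refine ⟨Real.exp (123 + 3 * (N₁ : ℝ) ^ 2), fun a haA x y hp hxy => ?_⟩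
  have hApos : 0 < |(a : ℝ)| := lt_of_lt_of_le (Real.exp_pos _) haA
  have ha : a ≠ 0 := by
    rintro rfl; simp at hApos
  have hS : ∀ p ∈ (∅ : Finset ℕ), p.Prime := fun p hp => absurd hp (Finset.notMem_empty p)
  obtain ⟨hM, h4, h9⟩ := mordellLevel_dvd_facts hS (a : ℚ)
  -- the curve of Lemma 10.4 (`S = ∅`, `(x', y') = (x, y)`, `a' = a`)
  obtain ⟨W, hW, hWmin, u, -, -, -, hNdvd, ⟨m, hm, n, hn, hΔ⟩, -, hbound⟩ := h104 ∅ hS a ha x y hp hxy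
  haveI := hW
  haveI := hWmin
  haveI : NeZero (W.conductorNorm ℤ) := ⟨(conductorNorm_pos_holds W).ne'⟩
  obtain ⟨D⟩ := hmod W
  have hN11 : 11 ≤ W.conductorNorm ℤ := eleven_le_conductorNorm_of_modularity hmod W
  have h2h_ii := two_mul_height_le_of_prop_10_8_i hi W (W.conductorNorm ℤ) rfl hN11 D
  obtain ⟨W', hW', D', hf, hmin⟩ := Literature.NumberTheory.EllipticCurves.Pasten2024.exists_minimal_datum_in_class D
  obtain ⟨hi1, hi2, hi3⟩ := hi W (W.conductorNorm ℤ) rfl D W' D' hf hmin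
  have hαβ : vkmAlpha (W.conductorNorm ℤ) ≤ vkmBeta (W.conductorNorm ℤ) := min_le_left _ _
  have hL := hbound D.L D.isNeronLattice
  have hszW := log_minimalDiscriminant_le_of_prop_10_8_i hmod hi W
  have hloga := log_abs_le_of_delta_eq ha hm hn hΔ
  have hNM : W.conductorNorm ℤ ∣ mordellLevel ∅ (a : ℚ) := by exact_mod_cast hNdvd
  obtain ⟨hν, -, -, -, -, hNM'⟩ := nu_terms_le hN11 hNM hM h4 h9
  have hν0 := condNu_nonneg (W.conductorNorm ℤ)
  have hνN := condNu_le_self (W.conductorNorm ℤ)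
  have hM' : (1728 : ℝ) ≤ (mordellLevel ∅ (a : ℚ) : ℝ) := by exact_mod_cast hM
  have hlow : 123 + 3 * (N₁ : ℝ) ^ 2 ≤ Real.log |(a : ℝ)| := by
    rw [Real.le_log_iff_exp_le hApos]; exact haA
  -- `N ≥ N₁`
  have hN1 : N₁ ≤ W.conductorNorm ℤ := conductor_ge_of_log_abs_ge hN11 hν0 hνN hszW hloga hlow
  have hNN₀ : N₀ ≤ W.conductorNorm ℤ := le_trans (le_trans (le_max_left _ _) (le_max_left _ _)) hN1
  have hN16 : (16 : ℕ) ≤ W.conductorNorm ℤ := le_trans (le_trans (le_max_right _ _) (le_max_left _ _)) hN1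
  have hN16' : (16 : ℝ) ≤ (W.conductorNorm ℤ : ℝ) := by exact_mod_cast hN16
  have hM₁N : M₁ ≤ (W.conductorNorm ℤ : ℝ) := by
    have h1 : (⌈M₁⌉₊ : ℝ) ≤ (W.conductorNorm ℤ : ℝ) := by exact_mod_cast le_trans (le_max_right _ _) hN1
    exact (Nat.le_ceil M₁).trans h1
  -- Prop. 10.8 (iii) at `N`, combined with (i)
  have hβ := hN₀ (W.conductorNorm ℤ) hNN₀
  have h2h : 2 * neronLatticeHeight D.L ≤ vkmKappa + (1 / 8 * condNu (W.conductorNorm ℤ) *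
      Real.log (W.conductorNorm ℤ) + (1 / 6 * Real.log 2 + δ / 4) / Real.log (Real.log (W.conductorNorm ℤ)) *
      (condNu (W.conductorNorm ℤ) * Real.log (W.conductorNorm ℤ))) := by linarith
  have h2h' : 2 * neronLatticeHeight D.L ≤ vkmKappa + (1 / 9 * (mordellLevel ∅ (a : ℚ) : ℝ) *
      Real.log (mordellLevel ∅ (a : ℚ)) + 1 / 24 * (mordellLevel ∅ (a : ℚ) : ℝ) *
      Real.log (Real.log (Real.log (mordellLevel ∅ (a : ℚ)))) + 2 / 27 * (mordellLevel ∅ (a : ℚ) : ℝ)) := by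
    obtain ⟨-, hν1, hν3, -, -, -⟩ := nu_terms_le hN11 hNM hM h4 h9
    linarith
  exact asymptotic_assembly hδ hM' (hM₁N.trans hNM') hN16' hNM' hν0 hν h2h h2h' hL

end VonKanelMatschke

end Literature.NumberTheory.DiophantineGeometry

end
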